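import Summits.Ventures.HodgeRepro2.T5SU11LegendreOrthogonal
import Summits.Ventures.HodgeRepro2.T5SU11JacobiLegendreLeading

/-!
# `P_n` is orthogonal to every polynomial of degree `< n`: `∫_{−1}^{1} q(x) P_n(x) dx = 0` for `deg q < n`

Row 383 (`T5SU11LegendreOrthogonal`) gives `∫_{−1}^{1} P_m P_n = 0` for `m ≠ n`; with `natDegree (legPoly d) = d` and
`lc(legPoly d) = legLead d ≠ 0` (row 372) every polynomial of degree `≤ d` is `c · P_d` plus a polynomial of lower degree
(`Polynomial.degree_sub_lt`), so by strong induction on the degree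

  **`∫_{−1}^{1} q(x) P_n(x) dx = 0` for every `q ∈ ℝ[X]` with `natDegree q < n`**
  (`integral_eval_mul_legP_eq_zero_of_natDegree_lt`, also in the `degree` form and with the factors swapped),

and every polynomial of degree `≤ d` is a linear combination of `P_0, …, P_d` (`exists_eq_sum_C_mul_legPoly`). This is
the orthogonality input of Gauss–Legendre quadrature. Nothing is claimed about (N).

Blind lane: Mathlib + the HodgeRepro2 prefix only; no sorry; axioms ⊆ {propext, Classical.choice,
Quot.sound}.
-/

namespace Summit.Ventures.HodgeRepro2.T5SU11LegendreOrthogonalLower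

open Polynomial intervalIntegral Finset
open T5SU11SphericalLegendreAll T5SU11JacobiPhaseLawEven T5SU11JacobiLegendreLeading T5SU11LegendreIdentities
  T5SU11LegendreOrthogonal

/-- Row 383 in polynomial form: `∫_{−1}^{1} (legPoly k)(x) P_n(x) dx = 0` for `k ≠ n`. -/
theorem integral_eval_legPoly_mul_legP_of_ne {k n : ℕ} (h : k ≠ n) :
    ∫ x in (-1 : ℝ)..1, (legPoly k).eval x * legP n x = 0 := by
  simp_rw [← legP_eq_eval]
  exact integral_legP_mul_legP_of_ne h

/-- **Reduction of the degree**: a polynomial `q ≠ 0` of degree `d` is `c · legPoly d + q'` with `degree q' < d`. -/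
theorem exists_sub_C_mul_legPoly_degree_lt {q : ℝ[X]} (hq0 : q ≠ 0) :
    ∃ c : ℝ, (q - C c * legPoly q.natDegree).degree < q.natDegree := by
  set d := q.natDegree with hd
  refine ⟨q.leadingCoeff / legLead d, ?_⟩
  have hl : legLead d ≠ 0 := (legLead_pos d).ne'
  have hc : q.leadingCoeff / legLead d ≠ 0 := div_ne_zero (leadingCoeff_ne_zero.mpr hq0) hl
  have hdeg : (C (q.leadingCoeff / legLead d) * legPoly d).degree = q.degree := by
    rw [degree_C_mul hc, degree_eq_natDegree (legPoly_ne_zero' d), natDegree_legPoly, degree_eq_natDegree hq0]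
  have hlc : (C (q.leadingCoeff / legLead d) * legPoly d).leadingCoeff = q.leadingCoeff := by
    rw [leadingCoeff_mul, leadingCoeff_C, leadingCoeff_legPoly, div_mul_cancel₀ _ hl]
  have := degree_sub_lt hdeg.symm hq0 hlc.symm
  rwa [degree_eq_natDegree hq0] at this
where
  /-- `legPoly d ≠ 0`. -/
  legPoly_ne_zero' (d : ℕ) : legPoly d ≠ 0 := by
    intro h
    have := leadingCoeff_legPoly d
    rw [h, leadingCoeff_zero] at this
    exact (legLead_pos d).ne this

/-- **`P_n` is orthogonal to every polynomial of degree `≤ d < n`** (strong induction on `d`). -/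
theorem integral_eval_mul_legP_eq_zero_aux (n : ℕ) :
    ∀ d : ℕ, d < n → ∀ q : ℝ[X], q.natDegree ≤ d → ∫ x in (-1 : ℝ)..1, q.eval x * legP n x = 0 := by
  intro d
  induction d using Nat.strong_induction_on with
  | _ d ih =>
    intro hd q hq
    by_cases hq0 : q = 0
    · simp [hq0]
    rcases lt_or_eq_of_le hq with hlt | heq
    · exact ih q.natDegree hlt (by omega) q le_rfl
    · obtain ⟨c, hc⟩ := exists_sub_C_mul_legPoly_degree_lt hq0
      rw [heq] at hc
      set q' := q - C c * legPoly d with hq'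
      have hq'deg : q' = 0 ∨ q'.natDegree < d := by
        by_cases h0 : q' = 0
        · exact Or.inl h0
        · exact Or.inr ((natDegree_lt_iff_degree_lt h0).mpr hc)
      have e : ∀ x, q.eval x * legP n x = q'.eval x * legP n x + c * ((legPoly d).eval x * legP n x) := fun x => by
        rw [hq', eval_sub, eval_mul, eval_C]
        ring
      simp_rw [e]
      have h1 : IntervalIntegrable (fun x => q'.eval x * legP n x) MeasureTheory.volume (-1 : ℝ) 1 :=
        (q'.continuous.mul (continuous_legP n)).intervalIntegrable _ _
      have h2 : IntervalIntegrable (fun x => c * ((legPoly d).eval x * legP n x)) MeasureTheory.volume (-1 : ℝ) 1 :=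
        (continuous_const.mul ((legPoly d).continuous.mul (continuous_legP n))).intervalIntegrable _ _
      rw [integral_add h1 h2, integral_const_mul, integral_eval_legPoly_mul_legP_of_ne (by omega), mul_zero,
        add_zero]
      rcases hq'deg with hq'0 | hq'lt
      · simp [hq'0]
      · exact ih q'.natDegree hq'lt (by omega) q' le_rfl

/-- **`∫_{−1}^{1} q(x) P_n(x) dx = 0` for `natDegree q < n`.** -/
theorem integral_eval_mul_legP_eq_zero_of_natDegree_lt {n : ℕ} {q : ℝ[X]} (hq : q.natDegree < n) :
    ∫ x in (-1 : ℝ)..1, q.eval x * legP n x = 0 :=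
  integral_eval_mul_legP_eq_zero_aux n q.natDegree hq q le_rfl

/-- **`∫_{−1}^{1} q(x) P_n(x) dx = 0` for `degree q < n`.** -/
theorem integral_eval_mul_legP_eq_zero_of_degree_lt {n : ℕ} {q : ℝ[X]} (hq : q.degree < n) :
    ∫ x in (-1 : ℝ)..1, q.eval x * legP n x = 0 := by
  by_cases hq0 : q = 0
  · simp [hq0]
  · exact integral_eval_mul_legP_eq_zero_of_natDegree_lt ((natDegree_lt_iff_degree_lt hq0).mpr hq)

/-- The same with the factors swapped. -/
theorem integral_legP_mul_eval_eq_zero_of_natDegree_lt {n : ℕ} {q : ℝ[X]} (hq : q.natDegree < n) :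
    ∫ x in (-1 : ℝ)..1, legP n x * q.eval x = 0 := by
  simp_rw [mul_comm (legP n _)]
  exact integral_eval_mul_legP_eq_zero_of_natDegree_lt hq

/-- **Every polynomial of degree `≤ d` is a linear combination of `P_0, …, P_d`.** -/
theorem exists_eq_sum_C_mul_legPoly : ∀ (d : ℕ) (q : ℝ[X]), q.natDegree ≤ d →
    ∃ c : ℕ → ℝ, q = ∑ k ∈ range (d + 1), C (c k) * legPoly k := by
  intro d
  induction d using Nat.strong_induction_on with
  | _ d ih =>
    intro q hq
    by_cases hq0 : q = 0
    · exact ⟨fun _ => 0, by simp [hq0]⟩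
    rcases lt_or_eq_of_le hq with hlt | heq
    · set m := q.natDegree with hm
      obtain ⟨c, hc⟩ := ih m hlt q le_rfl
      refine ⟨fun k => if k ≤ m then c k else 0, ?_⟩
      rw [hc, ← Finset.sum_range_add_sum_Ico _ (show m + 1 ≤ d + 1 by omega)]
      rw [Finset.sum_eq_zero (s := Finset.Ico _ _) fun k hk => by
        have := (Finset.mem_Ico.mp hk).1
        simp only [if_neg (show ¬ k ≤ m by omega), map_zero, zero_mul], add_zero]
      exact Finset.sum_congr rfl fun k hk => by
        have := Finset.mem_range.mp hk
        simp only [if_pos (show k ≤ m by omega)]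
    · obtain ⟨a, ha⟩ := exists_sub_C_mul_legPoly_degree_lt hq0
      rw [heq] at ha
      set q' := q - C a * legPoly d with hq'
      have hqeq : q = q' + C a * legPoly d := by rw [hq']; ring
      have hq'deg : q' = 0 ∨ q'.natDegree < d := by
        by_cases h0 : q' = 0
        · exact Or.inl h0
        · exact Or.inr ((natDegree_lt_iff_degree_lt h0).mpr ha)
      rcases hq'deg with hq'0 | hq'lt
      · refine ⟨fun k => if k < d then 0 else a, ?_⟩
        rw [hqeq, hq'0, zero_add, Finset.sum_range_succ (n := d)]
        simp only [if_neg (lt_irrefl d)]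
        rw [Finset.sum_eq_zero fun k hk => by
          simp only [if_pos (Finset.mem_range.mp hk), map_zero, zero_mul], zero_add]
      · obtain ⟨c, hc⟩ := ih (d - 1) (by omega) q' (by omega)
        rw [show d - 1 + 1 = d by omega] at hc
        refine ⟨fun k => if k < d then c k else a, ?_⟩
        rw [hqeq, hc, Finset.sum_range_succ (n := d)]
        simp only [if_neg (lt_irrefl d)]
        congr 1
        exact Finset.sum_congr rfl fun k hk => by simp only [if_pos (Finset.mem_range.mp hk)]

end Summit.Ventures.HodgeRepro2.T5SU11LegendreOrthogonalLower
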